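import Summits.BirchSwinnertonDyer.Rank1Residual.P2.CongruentNumberThetaThreePrimesDescent
import HarnessLib
import HarnessLib.Audit.Tags

/-!
# Cell «bsd-monsky» (prover-B): route B's operator `θ` at `k = 3` — the type `(3, 7, 7)`:
# `n = 2p₁p₂p₃`, `p₁ ≡ 3`, `p₂ ≡ p₃ ≡ 7 (mod 8)` ⟹ [`g(n) − 𝓛(p₂p₃)·g(2p₁)` odd ⟹ `𝓛(n)` odd], relative to the Literature
# display `tyz_cmPointGaloisData` and a rank input (kernel theorem; nothing asserted, nothing booked)

HONEST FRAMING (cell `bsd-monsky`, run/shared/lean/pub/bsd-monsky/; README §1/§3): the cell's CLAIMED theorem is Monsky's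
1990 conjecture on the `k = 2` family `𝒮⁻`; «ℓ ≥ 3 rungs (C-P2-2 for k ≥ 3) are NOT claimed — record what the same argument
gives there, no more». This is the second `θ`-controlled `k = 3` type of the scope note HOME/proof/PROOF-B-K3-SCOPE.md (census
kit j246343; prover-B g6) done IN THE KERNEL, after the type `(5, 5, 7)` (`P2/CongruentNumberThetaThreePrimes{,Descent,Family}.lean`).
Nothing is asserted: every statement is CONDITIONAL on TYZ data `D` with the displayed printed sentences (`D.Printed`,
`D.CMPointGaloisPrinted`) and a rank input; no conjecture is discharged, no count moves. NOT refereed; not part of PROOF-B v1.3.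

THE TYPE. Primes `p₁ ≡ 3 (mod 8)`, `p₂ ≡ p₃ ≡ 7 (mod 8)` (`p₂ ≠ p₃`), `m = p₁p₂p₃ ≡ 3`, `n = 2m ≡ 6 (mod 8)`. The recursion has FOUR
blocks: `R(n) = {2p₁, p₂, p₃}` (cofactors `p₂p₃ ≡ 1`, `2p₁p₃ ≡ 2`, `2p₁p₂ ≡ 2`), `R(2p₁) = R(p₂) = R(p₃) = ∅` (§1); all `ε = ±1`. With
`θ = θ^{(n)}`: (E6) at `n` and at the sub-block `2p₁` (`θ·(θ^{(2p₁)})⁻¹` trivial on `L_{2p₁}(i) = ℚ(i, √−2, √−p₁)`, J759), (E7) at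
`p₂`, `p₃` (§2); hence `(θ − 1)P(n) = (g(n) − 𝓛(p₂p₃)·g(2p₁))·τ((1−i)/2) + M·τ(1)` (§3) and, by the general core
(`odd_scriptL_of_theta_rec`), the RAW THEOREM (§4): `g(n) − 𝓛(p₂p₃)·g(2p₁)` odd ⟹ `𝓛(n)` odd. The companion file
`P2/CongruentNumberThetaThreePrimesBFamily.lean` evaluates the coefficient on Legendre symbols (`g(2p₁)` odd; `𝓛(p₂p₃)` EVEN by
TYZ Thm. 1.1 — a fourth named fact — with `g(p₂p₃)` even; `g(n)` odd ⟺ `(p₂p₃/p₁) = −1 ∧ (p₃/p₂) = (p₂/p₁)`; TYZ's `Σ₂′(n)` EVEN there).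
References: [TianYuanZhang2017] §3.1 (J738–J739), Prop. 3.2 (1)(2)(3), Thm. 3.3 (ε), Thm. 3.5, Thm. 3.6 (2) (J741), Lemma 3.18,
proof of Lemma 3.21 (J759); HOME/proof/PROOF-B.md v1.3 §7–§8, §10; HOME/proof/PROOF-B-K3-SCOPE.md §2–§4; HOME/proof/PROOF-B-K3-557.md.
-/

noncomputable section

open scoped Classical

open WeierstrassCurve WeierstrassCurve.Affine Literature.NumberTheory.EllipticCurves
  Literature.NumberTheory.EllipticCurves.Rank1Residual
  Literature.NumberTheory.EllipticCurves.Rank1Residual.Typed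
  Literature.NumberTheory.EllipticCurves.HeathBrown1994
  Literature.NumberTheory.EllipticCurves.Tian2014
  Literature.NumberTheory.EllipticCurves.TianYuanZhang2017
  Literature.NumberTheory.EllipticCurves.TianYuanZhang2017.W2
  Literature.NumberTheory.QuadraticFields.RedeiReichardt

set_option autoImplicit false

namespace Summit.BirchSwinnertonDyer.Rank1Residual.P2

namespace ThetaDescent

variable {n : ℕ}

/-! ## §1 Arithmetic of the type `(3, 7, 7)`: the recursion index sets -/

section Arith

variable {p₁ p₂ p₃ : ℕ}

/-- `recursionIndex (2p) = ∅` for a prime `p ≡ 3 (mod 8)` (`p ≢ 5, 6, 7`; the block `2p` has cofactor `1`).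
[cite: TianYuanZhang2017, §3.1 (p0011 L67–L70)] -/
theorem recursionIndex_two_mul_three_mod_eight (hp : p₁.Prime) (h3 : p₁ % 8 = 3) : recursionIndex (2 * p₁) = ∅ := by
  ext d₀
  simp only [recursionIndex, Finset.mem_filter, Nat.mem_divisors, Finset.notMem_empty, iff_false, not_and, not_lt]
  rintro ⟨hd, -⟩ h567 _
  rcases (dvd_prime_mul_prime_iff Nat.prime_two hp).mp hd with rfl | rfl | rfl | rfl
  · omega
  · omega
  · omega
  · rw [Nat.div_self (by omega)]

/-- `d₀ ∈ recursionIndex (2p₁p₂p₃)` ⟹ `d₀ ∈ {2p₁, p₂, p₃}` for the type `(3, 7, 7)` (cofactors `p₂p₃ ≡ 1`, `2p₁p₃ ≡ 2`, `2p₁p₂ ≡ 2`;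
the blocks `p₁pⱼ ≡ 5`, `2pⱼ ≡ 6` have cofactors `2pₖ ≡ 6`, `p₁pₖ ≡ 5`). [cite: TianYuanZhang2017, §3.1 (p0011 L67–L70)] -/
theorem mem_recursionIndex_n_377 (hp₁ : p₁.Prime) (hp₂ : p₂.Prime) (hp₃ : p₃.Prime) (h₁ : p₁ % 8 = 3) (h₂ : p₂ % 8 = 7)
    (h₃ : p₃ % 8 = 7) {d₀ : ℕ} (hd₀ : d₀ ∈ recursionIndex (2 * (p₁ * p₂ * p₃))) :
    d₀ = 2 * p₁ ∨ d₀ = p₂ ∨ d₀ = p₃ := by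
  have h12 : (p₁ * p₂) % 8 = 5 := by rw [Nat.mul_mod, h₁, h₂]
  have h13 : (p₁ * p₃) % 8 = 5 := by rw [Nat.mul_mod, h₁, h₃]
  have h23 : (p₂ * p₃) % 8 = 1 := by rw [Nat.mul_mod, h₂, h₃]
  have hm3 : (p₁ * p₂ * p₃) % 8 = 3 := by rw [Nat.mul_mod, h12, h₃]
  have hn0 : 2 * (p₁ * p₂ * p₃) ≠ 0 :=
    Nat.mul_ne_zero two_ne_zero (Nat.mul_ne_zero (Nat.mul_ne_zero hp₁.ne_zero hp₂.ne_zero) hp₃.ne_zero)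
  have e12 : 2 * (p₁ * p₂ * p₃) / (p₁ * p₂) = 2 * p₃ := by
    rw [show 2 * (p₁ * p₂ * p₃) = (p₁ * p₂) * (2 * p₃) by ring]
    exact Nat.mul_div_cancel_left _ (Nat.mul_pos hp₁.pos hp₂.pos)
  have e13 : 2 * (p₁ * p₂ * p₃) / (p₁ * p₃) = 2 * p₂ := by
    rw [show 2 * (p₁ * p₂ * p₃) = (p₁ * p₃) * (2 * p₂) by ring]
    exact Nat.mul_div_cancel_left _ (Nat.mul_pos hp₁.pos hp₃.pos)
  have e2p₂ : 2 * (p₁ * p₂ * p₃) / (2 * p₂) = p₁ * p₃ := by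
    rw [show 2 * (p₁ * p₂ * p₃) = (2 * p₂) * (p₁ * p₃) by ring]; exact Nat.mul_div_cancel_left _ (by omega)
  have e2p₃ : 2 * (p₁ * p₂ * p₃) / (2 * p₃) = p₁ * p₂ := by
    rw [show 2 * (p₁ * p₂ * p₃) = (2 * p₃) * (p₁ * p₂) by ring]; exact Nat.mul_div_cancel_left _ (by omega)
  simp only [recursionIndex, Finset.mem_filter, Nat.mem_divisors] at hd₀
  obtain ⟨⟨hd, -⟩, h567, h123, hgt⟩ := hd₀
  rcases (dvd_two_mul_three_iff hp₁ hp₂ hp₃).mp hd with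
    (rfl | rfl | rfl | rfl | rfl | rfl | rfl | rfl) | (rfl | rfl | rfl | rfl | rfl | rfl | rfl | rfl)
  · omega
  · omega
  · exact Or.inr (Or.inl rfl)
  · exact Or.inr (Or.inr rfl)
  · rw [e12] at h123; omega
  · rw [e13] at h123; omega
  · omega
  · omega
  · omega
  · exact Or.inl rfl
  · rw [e2p₂] at h123; omega
  · rw [e2p₃] at h123; omega
  · omega
  · omega
  · omega
  · rw [Nat.div_self (Nat.pos_of_ne_zero hn0)] at hgt; omega

/-- `2p₁ ∈ recursionIndex (2p₁p₂p₃)` (cofactor `p₂p₃ ≡ 1`). [cite: TianYuanZhang2017, §3.1 (p0011 L67–L70)] -/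
theorem two_mul_mem_recursionIndex_n_377 (hp₁ : p₁.Prime) (hp₂ : p₂.Prime) (hp₃ : p₃.Prime) (h₁ : p₁ % 8 = 3)
    (h₂ : p₂ % 8 = 7) (h₃ : p₃ % 8 = 7) : 2 * p₁ ∈ recursionIndex (2 * (p₁ * p₂ * p₃)) := by
  have h23 : (p₂ * p₃) % 8 = 1 := by rw [Nat.mul_mod, h₂, h₃]
  have hn0 : 2 * (p₁ * p₂ * p₃) ≠ 0 :=
    Nat.mul_ne_zero two_ne_zero (Nat.mul_ne_zero (Nat.mul_ne_zero hp₁.ne_zero hp₂.ne_zero) hp₃.ne_zero)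
  have e : 2 * (p₁ * p₂ * p₃) / (2 * p₁) = p₂ * p₃ := by
    rw [show 2 * (p₁ * p₂ * p₃) = (2 * p₁) * (p₂ * p₃) by ring]; exact Nat.mul_div_cancel_left _ (by omega)
  simp only [recursionIndex, Finset.mem_filter, Nat.mem_divisors]
  refine ⟨⟨Dvd.intro (p₂ * p₃) (by ring), hn0⟩, Or.inr (Or.inl (by omega)), ?_, ?_⟩
  · rw [e]; omega
  · rw [e]; have := Nat.mul_le_mul hp₂.two_le hp₃.two_le; omega

end Arith

/-! ## §2 The `θ`-evaluation package of the type `(3, 7, 7)` from the Literature display -/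

section Blocks

variable {p₁ p₂ p₃ : ℕ}

/-- **The `θ`-evaluation package of the type `(3, 7, 7)`.** From `D.CMPointGaloisPrinted`: the top block's lift `θ = θ^{(n)}` of
`σ_{1+ϖ}` satisfies `θ(√−n) = √−n`, `θ(i) = −i`, `θ(√−2) = −√−2`, the evaluations (E6) at `n` and at `2p₁`, and (E7) at `p₂`, `p₃`.
[cite: TianYuanZhang2017, §3.1 (J738–J739), Prop. 3.2 (1)(2)(3), Thm. 3.6 (2) (J741), proof of Lemma 3.21 (J759)] -/
theorem theta_package_377 (hp₁ : p₁.Prime) (hp₂ : p₂.Prime) (hp₃ : p₃.Prime) (h₁ : p₁ % 8 = 3) (h₂ : p₂ % 8 = 7)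
    (h₃ : p₃ % 8 = 7) (D : GenusPointData (2 * (p₁ * p₂ * p₃))) (hG : D.CMPointGaloisPrinted) :
    ∃ θ : D.H ≃ₐ[ℚ] D.H,
      θ (D.sqrtNeg (2 * (p₁ * p₂ * p₃))) = D.sqrtNeg (2 * (p₁ * p₂ * p₃)) ∧ θ D.im = -D.im ∧
      θ (D.sqrtNeg 2) = -D.sqrtNeg 2 ∧
      (∃ M : ℤ, thetaPt D θ (D.Z (2 * (p₁ * p₂ * p₃))) - D.Z (2 * (p₁ * p₂ * p₃)) =
        (gK (2 * (p₁ * p₂ * p₃)) : ℤ) • D.tauHalfOneMinusI + M • tauOne) ∧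
      (∃ M : ℤ, thetaPt D θ (D.Z (2 * p₁)) - D.Z (2 * p₁) = (gK (2 * p₁) : ℤ) • D.tauHalfOneMinusI + M • tauOne) ∧
      thetaPt D θ (D.Z p₂) = D.Z p₂ ∧ thetaPt D θ (D.Z p₃) = D.Z p₃ := by
  obtain ⟨z, Φ, ΓH, ΓH', σ, θ, c, -, hblk⟩ := hG
  have hp₁2 : p₁ ≠ 2 := by omega
  have hp₂2 : p₂ ≠ 2 := by omega
  have hp₃2 : p₃ ≠ 2 := by omega
  have hp₁o : Odd p₁ := hp₁.odd_of_ne_two hp₁2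
  have hp₂o : Odd p₂ := hp₂.odd_of_ne_two hp₂2
  have hp₃o : Odd p₃ := hp₃.odd_of_ne_two hp₃2
  have h12m : (p₁ * p₂) % 8 = 5 := by rw [Nat.mul_mod, h₁, h₂]
  have h23m : (p₂ * p₃) % 8 = 1 := by rw [Nat.mul_mod, h₂, h₃]
  have hm3 : (p₁ * p₂ * p₃) % 8 = 3 := by rw [Nat.mul_mod, h12m, h₃]
  have hn6 : (2 * (p₁ * p₂ * p₃)) % 8 = 6 := by omega
  have h2p₁ : (2 * p₁) % 8 = 6 := by omega
  have hm0 : p₁ * p₂ * p₃ ≠ 0 := Nat.mul_ne_zero (Nat.mul_ne_zero hp₁.ne_zero hp₂.ne_zero) hp₃.ne_zero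
  have hn0 : 2 * (p₁ * p₂ * p₃) ≠ 0 := Nat.mul_ne_zero two_ne_zero hm0
  have hn : 2 * (p₁ * p₂ * p₃) ∈ (2 * (p₁ * p₂ * p₃)).divisors := Nat.mem_divisors_self _ hn0
  have h2n : 2 ∈ (2 * (p₁ * p₂ * p₃)).divisors := Nat.mem_divisors.mpr ⟨Dvd.intro _ rfl, hn0⟩
  have hp₁n : p₁ ∈ (2 * (p₁ * p₂ * p₃)).divisors := Nat.mem_divisors.mpr ⟨Dvd.intro (2 * (p₂ * p₃)) (by ring), hn0⟩
  have hp₂n : p₂ ∈ (2 * (p₁ * p₂ * p₃)).divisors := Nat.mem_divisors.mpr ⟨Dvd.intro (2 * (p₁ * p₃)) (by ring), hn0⟩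
  have hp₃n : p₃ ∈ (2 * (p₁ * p₂ * p₃)).divisors := Nat.mem_divisors.mpr ⟨Dvd.intro (2 * (p₁ * p₂)) (by ring), hn0⟩
  have h23n : p₂ * p₃ ∈ (2 * (p₁ * p₂ * p₃)).divisors := Nat.mem_divisors.mpr ⟨Dvd.intro (2 * p₁) (by ring), hn0⟩
  have hmn : p₁ * p₂ * p₃ ∈ (2 * (p₁ * p₂ * p₃)).divisors := Nat.mem_divisors.mpr ⟨Dvd.intro 2 (by ring), hn0⟩
  have h2p₁n : 2 * p₁ ∈ (2 * (p₁ * p₂ * p₃)).divisors := Nat.mem_divisors.mpr ⟨Dvd.intro (p₂ * p₃) (by ring), hn0⟩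
  have hgp₁ : D.genusRoot p₁ = D.sqrtNeg p₁ := by unfold GenusPointData.genusRoot; rw [if_neg (by omega)]
  have hgp₂ : D.genusRoot p₂ = D.sqrtNeg p₂ := by unfold GenusPointData.genusRoot; rw [if_neg (by omega)]
  have hgp₃ : D.genusRoot p₃ = D.sqrtNeg p₃ := by unfold GenusPointData.genusRoot; rw [if_neg (by omega)]
  have hg23 : D.genusRoot (p₂ * p₃) = D.im * D.sqrtNeg (p₂ * p₃) := by
    unfold GenusPointData.genusRoot; rw [if_pos (by omega)]
  have hgm : D.genusRoot (p₁ * p₂ * p₃) = D.sqrtNeg (p₁ * p₂ * p₃) := by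
    unfold GenusPointData.genusRoot; rw [if_neg (by omega)]
  have sq_n := D.sqrtNeg_sq _ hn
  have sq_2 := D.sqrtNeg_sq _ h2n
  have sq_p₁ := D.sqrtNeg_sq _ hp₁n
  have sq_23 := D.sqrtNeg_sq _ h23n
  have sq_m := D.sqrtNeg_sq _ hmn
  have sq_2p₁ := D.sqrtNeg_sq _ h2p₁n
  have him0 : D.im ≠ 0 := im_ne_zero D
  obtain ⟨hBn, hTn, -⟩ := hblk _ hn
  obtain ⟨⟨-, -⟩, -, ⟨hΓn'z, -, -⟩, ⟨-, hΓngen⟩, -, ⟨-, -, hσnz⟩, -⟩ := hBn (Or.inr hn6)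
  obtain ⟨hθK, ⟨m₀, h36⟩, hθH, hθθσ⟩ := hTn hn6
  set Θ := θ (2 * (p₁ * p₂ * p₃)) with hΘdef
  have hΘsq : thetaPt D Θ (thetaPt D Θ (z (2 * (p₁ * p₂ * p₃)))) = z (2 * (p₁ * p₂ * p₃)) + tauOne := by
    have hmul : Θ * Θ = Θ * Θ * (σ (2 * (p₁ * p₂ * p₃)))⁻¹ * σ (2 * (p₁ * p₂ * p₃)) := by group
    rw [← thetaPt_mul, hmul, thetaPt_mul]
    show thetaPt D _ (D.galPt (σ _) (z _)) = _
    rw [hσnz, map_add, (thetaPt_tauOne_tauHalf D _).1]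
    show D.galPt _ (z _) + tauOne = _
    rw [hΓn'z _ hθθσ]
  have hΘi : Θ D.im = -D.im := theta_im_eq_neg_of_thm36 D Θ (z (2 * (p₁ * p₂ * p₃))) m₀ h36 hΘsq
  obtain ⟨-, hΘgen⟩ := hΓngen Θ hθH
  have hΘp₁ : Θ (D.sqrtNeg p₁) = D.sqrtNeg p₁ := by rw [← hgp₁]; exact hΘgen p₁ hp₁n hp₁o hp₁.one_lt
  have hΘp₂ : Θ (D.sqrtNeg p₂) = D.sqrtNeg p₂ := by rw [← hgp₂]; exact hΘgen p₂ hp₂n hp₂o hp₂.one_lt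
  have hΘp₃ : Θ (D.sqrtNeg p₃) = D.sqrtNeg p₃ := by rw [← hgp₃]; exact hΘgen p₃ hp₃n hp₃o hp₃.one_lt
  have hΘr23 : Θ (D.im * D.sqrtNeg (p₂ * p₃)) = D.im * D.sqrtNeg (p₂ * p₃) := by
    rw [← hg23]
    exact hΘgen (p₂ * p₃) h23n (hp₂o.mul hp₃o) (by have := Nat.mul_le_mul hp₂.two_le hp₃.two_le; omega)
  have hΘm : Θ (D.sqrtNeg (p₁ * p₂ * p₃)) = D.sqrtNeg (p₁ * p₂ * p₃) := by
    rw [← hgm]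
    exact hΘgen _ hmn ((hp₁o.mul hp₂o).mul hp₃o)
      (by have := Nat.mul_le_mul (Nat.mul_le_mul hp₁.two_le hp₂.two_le) hp₃.two_le; omega)
  -- `Θ(√−2) = −√−2`
  have hΘ2 : Θ (D.sqrtNeg 2) = -D.sqrtNeg 2 := by
    have hsq : (D.sqrtNeg (p₁ * p₂ * p₃) * D.sqrtNeg 2) ^ 2 = (D.im * D.sqrtNeg (2 * (p₁ * p₂ * p₃))) ^ 2 := by
      rw [mul_pow, mul_pow, D.im_sq, sq_m, sq_2, sq_n]; push_cast; ring
    have hy : Θ (D.im * D.sqrtNeg (2 * (p₁ * p₂ * p₃))) = -(D.im * D.sqrtNeg (2 * (p₁ * p₂ * p₃))) := by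
      rw [map_mul, hΘi, hθK]; ring
    exact neg_of_neg_mul_left D Θ (sqrtNeg_ne_zero D hmn) hΘm (neg_of_sq_eq_sq D Θ hsq hy)
  -- `Θ` fixes `√−2p₁`: `(i√−p₂p₃ · √−2p₁)² = (√−n)²`
  have hΘ2p₁ : Θ (D.sqrtNeg (2 * p₁)) = D.sqrtNeg (2 * p₁) := by
    have hsq : (D.im * D.sqrtNeg (p₂ * p₃) * D.sqrtNeg (2 * p₁)) ^ 2 = D.sqrtNeg (2 * (p₁ * p₂ * p₃)) ^ 2 := by
      rw [mul_pow, mul_pow, D.im_sq, sq_23, sq_2p₁, sq_n]; push_cast; ring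
    exact fix_of_fix_mul_left D Θ (mul_ne_zero him0 (sqrtNeg_ne_zero D h23n)) hΘr23 (fix_of_sq_eq_sq D Θ hsq hθK)
  refine ⟨Θ, hθK, hΘi, hΘ2, ?_, ?_, ?_, ?_⟩
  · -- (E6) at the top block
    exact theta_sub_Z_of_six_block D hn (by omega) (hBn (Or.inr hn6)) (hTn hn6) Θ hθK
      (by rw [mul_inv_cancel]; exact ⟨rfl, fun _ _ _ => rfl⟩)
  · -- (E6) at the block `2p₁`
    obtain ⟨hB2, hT2, -⟩ := hblk _ h2p₁n
    obtain ⟨⟨-, -⟩, -, ⟨hΓ2'z, -, -⟩, ⟨-, hΓ2gen⟩, -, ⟨-, -, hσ2z⟩, -⟩ := hB2 (Or.inr h2p₁)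
    obtain ⟨hθ₂K, ⟨m₂, h36₂⟩, hθ₂H, hθθσ₂⟩ := hT2 h2p₁
    set θ₂ := θ (2 * p₁) with hθ₂def
    have hθ₂sq : thetaPt D θ₂ (thetaPt D θ₂ (z (2 * p₁))) = z (2 * p₁) + tauOne := by
      have hmul : θ₂ * θ₂ = θ₂ * θ₂ * (σ (2 * p₁))⁻¹ * σ (2 * p₁) := by group
      rw [← thetaPt_mul, hmul, thetaPt_mul]
      show thetaPt D _ (D.galPt (σ _) (z _)) = _
      rw [hσ2z, map_add, (thetaPt_tauOne_tauHalf D _).1]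
      show D.galPt _ (z _) + tauOne = _
      rw [hΓ2'z _ hθθσ₂]
    have hθ₂i : θ₂ D.im = -D.im := theta_im_eq_neg_of_thm36 D θ₂ (z (2 * p₁)) m₂ h36₂ hθ₂sq
    obtain ⟨-, hθ₂gen⟩ := hΓ2gen θ₂ hθ₂H
    have hp₁d : p₁ ∈ (2 * p₁).divisors := Nat.mem_divisors.mpr ⟨Dvd.intro_left 2 rfl, by omega⟩
    have hθ₂p₁ : θ₂ (D.sqrtNeg p₁) = D.sqrtNeg p₁ := by rw [← hgp₁]; exact hθ₂gen p₁ hp₁d hp₁o hp₁.one_lt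
    have hsq2 : (D.sqrtNeg p₁ * D.sqrtNeg 2) ^ 2 = (D.im * D.sqrtNeg (2 * p₁)) ^ 2 := by
      rw [mul_pow, mul_pow, D.im_sq, sq_p₁, sq_2, sq_2p₁]; push_cast; ring
    have hθ₂2 : θ₂ (D.sqrtNeg 2) = -D.sqrtNeg 2 := by
      have hy : θ₂ (D.im * D.sqrtNeg (2 * p₁)) = -(D.im * D.sqrtNeg (2 * p₁)) := by
        rw [map_mul, hθ₂i, hθ₂K]; ring
      exact neg_of_neg_mul_left D θ₂ (sqrtNeg_ne_zero D hp₁n) hθ₂p₁ (neg_of_sq_eq_sq D θ₂ hsq2 hy)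
    have hα : D.TrivialOnL (2 * p₁) (Θ * θ₂⁻¹) := by
      refine ⟨?_, ?_⟩
      · rw [AlgEquiv.mul_apply, inv_apply_eq_neg_of_apply_eq_neg D θ₂ hθ₂i, map_neg, hΘi, neg_neg]
      · intro d' hd' hd'1
        rw [AlgEquiv.mul_apply]
        rcases (dvd_prime_mul_prime_iff Nat.prime_two hp₁).mp (Nat.mem_divisors.mp hd').1 with rfl | rfl | rfl | rfl
        · omega
        · rw [inv_apply_eq_neg_of_apply_eq_neg D θ₂ hθ₂2, map_neg, hΘ2, neg_neg]
        · rw [inv_apply_of_apply_eq D θ₂ _ hθ₂p₁, hΘp₁]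
        · rw [inv_apply_of_apply_eq D θ₂ _ hθ₂K, hΘ2p₁]
    have hdd : 2 * p₁ ∈ (2 * p₁).divisors := Nat.mem_divisors_self _ (by omega)
    exact theta_sub_Z_of_six_block D hdd (by omega) (hB2 (Or.inr h2p₁)) (hT2 h2p₁) Θ hΘ2p₁ hα
  · -- (E7) at `p₂`
    obtain ⟨-, -, hS⟩ := hblk _ hp₂n
    refine hS h₂ Θ ⟨hΘp₂, ?_⟩
    intro d' hd' _ hd'1
    rcases (Nat.dvd_prime hp₂).mp (Nat.mem_divisors.mp hd').1 with rfl | rfl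
    · omega
    · rw [hgp₂]; exact hΘp₂
  · -- (E7) at `p₃`
    obtain ⟨-, -, hS⟩ := hblk _ hp₃n
    refine hS h₃ Θ ⟨hΘp₃, ?_⟩
    intro d' hd' _ hd'1
    rcases (Nat.dvd_prime hp₃).mp (Nat.mem_divisors.mp hd').1 with rfl | rfl
    · omega
    · rw [hgp₃]; exact hΘp₃

end Blocks

/-! ## §3 The four-block recursion under `θ − 1` -/

section Assembly

variable {p₁ p₂ p₃ : ℕ}

/-- **The recursion side for the type `(3, 7, 7)`**: `(θ − 1)P(n) = (g(n) − 𝓛(p₂p₃)·g(2p₁))·τ((1−i)/2) + M·τ(1)` from the displayed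
`recursion`, `epsSpec` and the block evaluations: `P(n) = Z(n) − ε𝓛(p₂p₃)Z(2p₁) − ε′𝓛(2p₁p₃)Z(p₂) − ε″𝓛(2p₁p₂)Z(p₃)` (all `ε = ±1`;
`P(2p₁) = Z(2p₁)`, `P(pᵢ) = Z(pᵢ)`). [cite: TianYuanZhang2017, §3.1 (p0011 L67–L73), Thm. 3.3 (p0011 L49–L51)] -/
theorem theta_sub_P_377 (hp₁ : p₁.Prime) (hp₂ : p₂.Prime) (hp₃ : p₃.Prime) (h₁ : p₁ % 8 = 3) (h₂ : p₂ % 8 = 7)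
    (h₃ : p₃ % 8 = 7) (D : GenusPointData (2 * (p₁ * p₂ * p₃))) (hrec : D.recursion) (heps : D.epsSpec)
    (θ : D.H ≃ₐ[ℚ] D.H) (hθi : θ D.im = -D.im)
    (hZn : ∃ M : ℤ, thetaPt D θ (D.Z (2 * (p₁ * p₂ * p₃))) - D.Z (2 * (p₁ * p₂ * p₃)) =
        (gK (2 * (p₁ * p₂ * p₃)) : ℤ) • D.tauHalfOneMinusI + M • tauOne)
    (hZ2p₁ : ∃ M : ℤ, thetaPt D θ (D.Z (2 * p₁)) - D.Z (2 * p₁) = (gK (2 * p₁) : ℤ) • D.tauHalfOneMinusI + M • tauOne)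
    (hZp₂ : thetaPt D θ (D.Z p₂) = D.Z p₂) (hZp₃ : thetaPt D θ (D.Z p₃) = D.Z p₃) :
    ∃ M : ℤ, thetaPt D θ (D.P (2 * (p₁ * p₂ * p₃))) - D.P (2 * (p₁ * p₂ * p₃)) =
      ((gK (2 * (p₁ * p₂ * p₃)) : ℤ) - D.scriptL (p₂ * p₃) * (gK (2 * p₁) : ℤ)) • D.tauHalfOneMinusI + M • tauOne := by
  have h12m : (p₁ * p₂) % 8 = 5 := by rw [Nat.mul_mod, h₁, h₂]
  have h23m : (p₂ * p₃) % 8 = 1 := by rw [Nat.mul_mod, h₂, h₃]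
  have hm3 : (p₁ * p₂ * p₃) % 8 = 3 := by rw [Nat.mul_mod, h12m, h₃]
  have hn6 : (2 * (p₁ * p₂ * p₃)) % 8 = 6 := by omega
  have h2p₁ : (2 * p₁) % 8 = 6 := by omega
  have hm0 : p₁ * p₂ * p₃ ≠ 0 := Nat.mul_ne_zero (Nat.mul_ne_zero hp₁.ne_zero hp₂.ne_zero) hp₃.ne_zero
  have hn0 : 2 * (p₁ * p₂ * p₃) ≠ 0 := Nat.mul_ne_zero two_ne_zero hm0
  have hn : 2 * (p₁ * p₂ * p₃) ∈ (2 * (p₁ * p₂ * p₃)).divisors := Nat.mem_divisors_self _ hn0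
  have hp₂n : p₂ ∈ (2 * (p₁ * p₂ * p₃)).divisors := Nat.mem_divisors.mpr ⟨Dvd.intro (2 * (p₁ * p₃)) (by ring), hn0⟩
  have hp₃n : p₃ ∈ (2 * (p₁ * p₂ * p₃)).divisors := Nat.mem_divisors.mpr ⟨Dvd.intro (2 * (p₁ * p₂)) (by ring), hn0⟩
  have h2p₁n : 2 * p₁ ∈ (2 * (p₁ * p₂ * p₃)).divisors := Nat.mem_divisors.mpr ⟨Dvd.intro (p₂ * p₃) (by ring), hn0⟩
  have qnp₂ : 2 * (p₁ * p₂ * p₃) / p₂ = 2 * (p₁ * p₃) := by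
    rw [show 2 * (p₁ * p₂ * p₃) = 2 * (p₁ * p₃) * p₂ by ring]; exact Nat.mul_div_cancel _ hp₂.pos
  have qnp₃ : 2 * (p₁ * p₂ * p₃) / p₃ = 2 * (p₁ * p₂) := by
    rw [show 2 * (p₁ * p₂ * p₃) = 2 * (p₁ * p₂) * p₃ by ring]; exact Nat.mul_div_cancel _ hp₃.pos
  have qn2p₁ : 2 * (p₁ * p₂ * p₃) / (2 * p₁) = p₂ * p₃ := by
    rw [show 2 * (p₁ * p₂ * p₃) = (2 * p₁) * (p₂ * p₃) by ring]; exact Nat.mul_div_cancel_left _ (by omega)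
  set S : AddSubgroup (APoint D.H) := AddSubgroup.zmultiples (tauOne : APoint D.H) with hS
  -- the prime blocks and the block `2p₁`
  have hPp₂ : D.P p₂ = D.Z p₂ := by
    have h := hrec p₂ hp₂n (Or.inr (Or.inr h₂))
    rwa [recursionIndex_prime hp₂, Finset.sum_empty, sub_zero] at h
  have hPp₃ : D.P p₃ = D.Z p₃ := by
    have h := hrec p₃ hp₃n (Or.inr (Or.inr h₃))
    rwa [recursionIndex_prime hp₃, Finset.sum_empty, sub_zero] at h
  have hP2p₁ : D.P (2 * p₁) = D.Z (2 * p₁) := by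
    have h := hrec (2 * p₁) h2p₁n (Or.inr (Or.inl h2p₁))
    rwa [recursionIndex_two_mul_three_mod_eight hp₁ h₁, Finset.sum_empty, sub_zero] at h
  have hDp₂ : thetaPt D θ (D.P p₂) - D.P p₂ = 0 := by rw [hPp₂, hZp₂, sub_self]
  have hDp₃ : thetaPt D θ (D.P p₃) - D.P p₃ = 0 := by rw [hPp₃, hZp₃, sub_self]
  obtain ⟨M₁, hM₁⟩ := hZ2p₁
  have hD2p₁ : thetaPt D θ (D.P (2 * p₁)) - D.P (2 * p₁) = (gK (2 * p₁) : ℤ) • D.tauHalfOneMinusI + M₁ • tauOne := by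
    rw [hP2p₁, hM₁]
  -- the top block
  obtain ⟨M₀, hM₀⟩ := hZn
  have hrecn := hrec (2 * (p₁ * p₂ * p₃)) hn (Or.inr (Or.inl hn6))
  have hsplit := Finset.add_sum_erase (recursionIndex (2 * (p₁ * p₂ * p₃)))
    (fun d₀ => cmIPow D.im D.im_sq (D.eps d₀ (2 * (p₁ * p₂ * p₃) / d₀))
      (D.scriptL (2 * (p₁ * p₂ * p₃) / d₀) • D.P d₀))
    (two_mul_mem_recursionIndex_n_377 hp₁ hp₂ hp₃ h₁ h₂ h₃)
  have hErase : thetaPt D θ (∑ d₀ ∈ (recursionIndex (2 * (p₁ * p₂ * p₃))).erase (2 * p₁),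
      cmIPow D.im D.im_sq (D.eps d₀ (2 * (p₁ * p₂ * p₃) / d₀)) (D.scriptL (2 * (p₁ * p₂ * p₃) / d₀) • D.P d₀)) -
      ∑ d₀ ∈ (recursionIndex (2 * (p₁ * p₂ * p₃))).erase (2 * p₁),
      cmIPow D.im D.im_sq (D.eps d₀ (2 * (p₁ * p₂ * p₃) / d₀)) (D.scriptL (2 * (p₁ * p₂ * p₃) / d₀) • D.P d₀) ∈ S := by
    rw [map_sum, ← Finset.sum_sub_distrib]
    refine sum_mem fun d₀ hd₀ => ?_
    obtain ⟨hne, hd₀'⟩ := Finset.mem_erase.mp hd₀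
    rcases mem_recursionIndex_n_377 hp₁ hp₂ hp₃ h₁ h₂ h₃ hd₀' with rfl | rfl | rfl
    · exact absurd rfl hne
    · rw [qnp₂, theta_sub_cmIPow_even D θ hθi (even_eps_of_not D heps (by omega)), hDp₂, smul_zero, map_zero]
      exact S.zero_mem
    · rw [qnp₃, theta_sub_cmIPow_even D θ hθi (even_eps_of_not D heps (by omega)), hDp₃, smul_zero, map_zero]
      exact S.zero_mem
  obtain ⟨K, hK⟩ := exists_eq_zsmul_of_mem_zmultiples_tauOne D hErase
  have he₁ : Even (D.eps (2 * p₁) (p₂ * p₃)) := even_eps_of_not D heps (by omega)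
  obtain ⟨j, hj⟩ := cmIPow_tauHalfOneMinusI D (D.eps (2 * p₁) (p₂ * p₃))
  refine ⟨M₀ - (D.scriptL (p₂ * p₃) * (gK (2 * p₁) : ℤ) * j + D.scriptL (p₂ * p₃) * M₁) - K, ?_⟩
  rw [hrecn, ← hsplit, map_sub, map_add, qn2p₁, sub_sub_sub_comm, hM₀, add_sub_add_comm, hK,
    theta_sub_cmIPow_even D θ hθi he₁, hD2p₁, smul_add, smul_smul, smul_smul, map_add, map_zsmul, map_zsmul, hj,
    cmIPow_tauOne]
  module

end Assembly

/-! ## §4 The raw theorem: `g(n) − 𝓛(p₂p₃)·g(2p₁)` odd ⟹ `𝓛(n)` odd -/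

section Raw

variable {p₁ p₂ p₃ : ℕ}

/-- `n = 2p₁p₂p₃` is square-free for the type `(3, 7, 7)` with `p₂ ≠ p₃`. [cite: HardyWright2008, §1.3 Thm. 2] -/
theorem squarefree_two_mul_377 (hp₁ : p₁.Prime) (hp₂ : p₂.Prime) (hp₃ : p₃.Prime) (h₁ : p₁ % 8 = 3) (h₂ : p₂ % 8 = 7)
    (h₃ : p₃ % 8 = 7) (h23 : p₂ ≠ p₃) : Squarefree (2 * (p₁ * p₂ * p₃)) := by
  have ht : ∀ i, ((![p₁, p₂, p₃] : Fin 3 → ℕ) i).Prime := fun i => by fin_cases i <;> assumption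
  have hodd : ∀ i, Odd ((![p₁, p₂, p₃] : Fin 3 → ℕ) i) := fun i => by
    fin_cases i <;> exact Nat.odd_iff.mpr (by simp; omega)
  have h12 : p₁ ≠ p₂ := fun h => by omega
  have h13 : p₁ ≠ p₃ := fun h => by omega
  have hinj : Function.Injective (![p₁, p₂, p₃] : Fin 3 → ℕ) := by
    intro i j h
    fin_cases i <;> fin_cases j <;> simp_all
  have h := squarefree_two_mul_prod_of_injective _ ht hodd hinj
  rwa [Fin.prod_univ_three] at h

/-- **The raw THEOREM of the type `(3, 7, 7)`** (modulo the display and a rank input): for TYZ data `D` at `n = 2p₁p₂p₃` with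
`D.Printed ∧ D.CMPointGaloisPrinted`, rank `E_n(ℚ) ≤ 1` once `𝓛(n) ≠ 0`: if `g(n) − 𝓛(p₂p₃)·g(2p₁)` (with the data's sign choice of
`𝓛(p₂p₃)`) is ODD, then `𝓛(n)` is ODD. (The companion family file shows `g(2p₁)` odd and `𝓛(p₂p₃)` even, so the hypothesis is `g(n)` odd.)
[cite: TianYuanZhang2017, Thm. 3.5 (p0011 L94–L112), Thm. 3.6 (2) (J741), Lemma 3.18, §3.1 (p0011 L67–L73), proof of Lemma 3.21 (J759)] -/
theorem odd_scriptL_two_mul_377_raw (hp₁ : p₁.Prime) (hp₂ : p₂.Prime) (hp₃ : p₃.Prime) (h₁ : p₁ % 8 = 3)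
    (h₂ : p₂ % 8 = 7) (h₃ : p₃ % 8 = 7) (h23 : p₂ ≠ p₃) (D : GenusPointData (2 * (p₁ * p₂ * p₃))) (hD : D.Printed)
    (hG : D.CMPointGaloisPrinted)
    (hr :
      letI := isElliptic_congruentNumberCurve (squarefree_two_mul_377 hp₁ hp₂ hp₃ h₁ h₂ h₃ h23).ne_zero
      D.scriptL (2 * (p₁ * p₂ * p₃)) ≠ 0 → (congruentNumberCurve (2 * (p₁ * p₂ * p₃))).mordellWeilRank ≤ 1)
    (hodd : Odd ((gK (2 * (p₁ * p₂ * p₃)) : ℤ) - D.scriptL (p₂ * p₃) * (gK (2 * p₁) : ℤ))) :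
    Odd (D.scriptL (2 * (p₁ * p₂ * p₃))) := by
  have hsq := squarefree_two_mul_377 hp₁ hp₂ hp₃ h₁ h₂ h₃ h23
  have h12m : (p₁ * p₂) % 8 = 5 := by rw [Nat.mul_mod, h₁, h₂]
  have hm3 : (p₁ * p₂ * p₃) % 8 = 3 := by rw [Nat.mul_mod, h12m, h₃]
  have hn6 : (2 * (p₁ * p₂ * p₃)) % 8 = 6 := by omega
  obtain ⟨hLspec, heps, hrec, -, h35, -, -, -, h318, -, -⟩ := hD
  obtain ⟨θ, hθK, hθi, hθ2, hZn, hZ2p₁, hZp₂, hZp₃⟩ := theta_package_377 hp₁ hp₂ hp₃ h₁ h₂ h₃ D hG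
  obtain ⟨M, hM⟩ := theta_sub_P_377 hp₁ hp₂ hp₃ h₁ h₂ h₃ D hrec heps θ hθi hZn hZ2p₁ hZp₂ hZp₃
  obtain ⟨hw2, hww⟩ := bZero D θ hθi
  exact odd_scriptL_of_theta_rec hsq hn6 D hLspec h35 h318 hr θ hθK hθi hθ2 (Or.inl hw2) hww hM hodd

end Raw

end ThetaDescent

end Summit.BirchSwinnertonDyer.Rank1Residual.P2

end
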